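import Literature.Barriers.CriticalPhenomena.PlaquetteWalkAngleLimitRowCoherence
import HarnessLib

/-!
# Barrier catalogue (SAWScalingLimit): the COLUMN-COHERENT phase classes of the level-`5` limit model (cells above / below the root
plaquette) and the non-vanishing criteria they give («COLUMN COHERENCE»)

Continuation of `PlaquetteWalkAngleLimitRowCoherence`. In the lane's exact census (b-engine-1 g24, kit j276221: 3 455 rooted domains,
6 784 cells of minimal wound cost `5`) the cost-`5` wound members at the cells ABOVE the root plaquette `w` (same column or to the
east, `2 112` cells) are all class-`B2b` extensions ending on the `N` side with phase index `X ∈ {3, 6}` (limit weights `4√2·ζ²⁰`,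
`4√2`), and at the cells BELOW they all end on `S` with `X ∈ {3, 0}` (weights `4√2·ζ⁴`, `4√2·ζ²⁴`). Each pair lies strictly inside
a half-plane: rotated by `ζ⁶` (above) resp. `ζ²` (below) both weights become `4√2·ζ⁶` or `4√2·ζ²⁶`, of real part
`4√2·cos(3π/8) > 0`.

* `zeta32_four_add_twelve_eq_sqrt` (`ζ⁴ + ζ¹² = √2·ζ⁸`), `zeta32_pow_re_pos'` (`Re ζ^k > 0` for `24 < k ≤ 32`),
  `limitWeight_eq_sqrt_of_cost_five` (a cost-`5` walk from a vertical root to a slanted slot has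
  `limitWeight = slotSign · 4√2 · ζ^{8 + 4X}`);
* `AboveCoherent` / `BelowCoherent` — the class predicates; ★★ `re_zeta6_mul_limitWeight_pos_of_aboveCoherent` /
  `re_zeta2_mul_limitWeight_pos_of_belowCoherent`;
* ★★★ `vertexFunctional_printed_zero_set_finite_of_aboveCoherent` / `…_of_belowCoherent`: at a `W`-normalised hole root, if every
  cost-`5` wound member at `f₀` is above-coherent (resp. below-coherent) and there is one, `VF_D(a, f₀; ·)` is NOT identically zero.

These are the target shapes of the column half of the «rectangle coefficient» law; the classification itself is not claimed.
[GlazmanManolescu2019 §1 eq. (1), Lemma 2.1 (CR); Glazman 2015 Lemma 3.1 (proof)]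
-/

noncomputable section

open private IsNS from Literature.Probability.RandomPlanarGeometry.YangBaxterSAWGeneralDomain

namespace Literature.Barriers.CriticalPhenomena.PlaquetteWalk

open Literature.Probability.RandomPlanarGeometry.SAW.YangBaxter
open Real Complex Polynomial

section Values

/-- `ζ⁴ + ζ¹² = √2 · ζ⁸` (`= i√2`). [cite: GlazmanManolescu2019, §1, eq. (1) (the limit weight `i√2` of a corner arc; lane plumbing)] -/
theorem zeta32_four_add_twelve_eq_sqrt : zeta32 ^ 4 + zeta32 ^ 12 = ((Real.sqrt 2 : ℝ) : ℂ) * zeta32 ^ 8 := by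
  have h4 : zeta32 ^ 4 = ((Real.cos (π / 4) : ℝ) : ℂ) + ((Real.sin (π / 4) : ℝ) : ℂ) * I := by
    rw [zeta32_pow, show (((4 : ℕ) : ℝ) * π / 16 : ℝ) = π / 4 by push_cast; ring, Complex.exp_mul_I, Complex.ofReal_cos,
      Complex.ofReal_sin]
  have h12 : zeta32 ^ 12 = ((Real.cos (3 * π / 4) : ℝ) : ℂ) + ((Real.sin (3 * π / 4) : ℝ) : ℂ) * I := by
    rw [zeta32_pow, show (((12 : ℕ) : ℝ) * π / 16 : ℝ) = 3 * π / 4 by push_cast; ring, Complex.exp_mul_I, Complex.ofReal_cos,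
      Complex.ofReal_sin]
  have c3 : Real.cos (3 * π / 4) = -(Real.sqrt 2 / 2) := by
    rw [show 3 * π / 4 = π - π / 4 by ring, Real.cos_pi_sub, Real.cos_pi_div_four]
  have s3 : Real.sin (3 * π / 4) = Real.sqrt 2 / 2 := by
    rw [show 3 * π / 4 = π - π / 4 by ring, Real.sin_pi_sub, Real.sin_pi_div_four]
  rw [h4, h12, zeta32_pow_eight, Real.cos_pi_div_four, Real.sin_pi_div_four, c3, s3]
  push_cast
  ring

/-- `Re ζ^k > 0` for `24 < k ≤ 32` (arguments in `(3π/2, 2π]`). [cite: GlazmanManolescu2019, §1, eq. (1) (lane plumbing)] -/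
theorem zeta32_pow_re_pos' {k : ℕ} (hk : 24 < k) (hk' : k ≤ 32) : 0 < (zeta32 ^ k).re := by
  have e : zeta32 ^ k = zeta32 ^ 32 * (zeta32 ^ (32 - k))⁻¹ := by
    rw [eq_mul_inv_iff_mul_eq₀ (pow_ne_zero _ zeta32_ne_zero), ← pow_add, show k + (32 - k) = 32 by omega]
  have hinv : (zeta32 ^ (32 - k))⁻¹ = starRingEnd ℂ (zeta32 ^ (32 - k)) := by
    rw [zeta32_pow, ← Complex.exp_conj, ← Complex.exp_neg]
    congr 1
    rw [map_mul, Complex.conj_ofReal, Complex.conj_I]; ring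
  rw [e, zeta32_pow_thirtyTwo, one_mul, hinv, Complex.conj_re]
  exact zeta32_pow_re_pos (by omega)

/-- `Re(√2 · ζ^k) = √2 · Re ζ^k` and it is positive for `k < 8` or `24 < k ≤ 32`. [cite: GlazmanManolescu2019, §1, eq. (1) (lane plumbing)] -/
theorem re_sqrt_two_mul_zeta32_pow_pos {k : ℕ} (hk : k < 8 ∨ (24 < k ∧ k ≤ 32)) :
    0 < (((Real.sqrt 2 : ℝ) : ℂ) * zeta32 ^ k).re := by
  rw [Complex.re_ofReal_mul]
  refine mul_pos (Real.sqrt_pos.2 (by norm_num)) ?_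
  rcases hk with h | ⟨h1, h2⟩
  · exact zeta32_pow_re_pos h
  · exact zeta32_pow_re_pos' h1 h2

variable {D : Set Face} {a z : MidEdge}

/-- ★ **A cost-`5` walk from a vertical root to a SLANTED slot has limit weight `slotSign · 4√2 · ζ^{8 + 4X}`.**
[cite: GlazmanManolescu2019, §1, Fig. 1 and eq. (1); Lemma 2.1, eq. (CR)] -/
theorem limitWeight_eq_sqrt_of_cost_five (γ : YBWalk D a z) (ha : vertB a = true) (s : Fin 4) (hz : vertB z = (slotDeg s == 0))
    (hs : slotDeg s = 1) (hc : cost s γ.mids = 5) :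
    limitWeight s γ.mids = slotSign s * (4 * ((Real.sqrt 2 : ℝ) : ℂ)) * zeta32 ^ (8 + 4 * phaseIndex γ.mids) := by
  rw [limitWeight_eq_phaseIndex γ ha s hz, isolated_eq_of_cost_five hc, hs, zeta32_four_add_twelve_pow_five,
    zeta32_four_add_twelve_eq_sqrt, pow_add]
  ring

end Values

/-! ## The classes and the rotated real parts -/

section Classes

/-- ★ **THE ABOVE-COHERENT CLASSES**: slot `N` with phase index `3` or `6` (the cost-`5` wound members at the cells above the root
plaquette, lane census). [cite: GlazmanManolescu2019, §1, Fig. 1 and eq. (1); Lemma 2.1, eq. (CR)] -/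
def AboveCoherent (s : Fin 4) (l : List MidEdge) : Prop := s = 1 ∧ (phaseIndex l = 3 ∨ phaseIndex l = 6)

/-- ★ **THE BELOW-COHERENT CLASSES**: slot `S` with phase index `3` or `0`. [cite: GlazmanManolescu2019, §1, Fig. 1 and eq. (1); Lemma 2.1, eq. (CR)] -/
def BelowCoherent (s : Fin 4) (l : List MidEdge) : Prop := s = 3 ∧ (phaseIndex l = 3 ∨ phaseIndex l = 0)

variable {D : Set Face} {a z : MidEdge}

/-- ★★ **ABOVE-COHERENT COST-`5` WEIGHTS ROTATED BY `ζ⁶` HAVE POSITIVE REAL PART**: `ζ⁶ · limitWeight = 4√2·ζ²⁶` (`X = 3`) or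
`4√2·ζ⁶` (`X = 6`), real part `4√2·cos(3π/8) > 0`. [cite: GlazmanManolescu2019, §1, Fig. 1 and eq. (1); Lemma 2.1, eq. (CR)] -/
theorem re_zeta6_mul_limitWeight_pos_of_aboveCoherent (γ : YBWalk D a z) (ha : vertB a = true) (s : Fin 4)
    (hz : vertB z = (slotDeg s == 0)) (hc : cost s γ.mids = 5) (hcoh : AboveCoherent s γ.mids) :
    0 < (zeta32 ^ 6 * limitWeight s γ.mids).re := by
  obtain ⟨rfl, hX⟩ := hcoh
  rw [limitWeight_eq_sqrt_of_cost_five γ ha 1 hz rfl hc, show slotSign 1 = 1 from rfl, one_mul]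
  have e : ∀ X : ℕ, zeta32 ^ 6 * (4 * ((Real.sqrt 2 : ℝ) : ℂ) * zeta32 ^ (8 + 4 * X)) =
      4 * (((Real.sqrt 2 : ℝ) : ℂ) * zeta32 ^ ((14 + 4 * X) % 32)) := by
    intro X
    rw [show zeta32 ^ 6 * (4 * ((Real.sqrt 2 : ℝ) : ℂ) * zeta32 ^ (8 + 4 * X)) =
      4 * (((Real.sqrt 2 : ℝ) : ℂ) * (zeta32 ^ 6 * zeta32 ^ (8 + 4 * X))) by ring, ← pow_add,
      show 6 + (8 + 4 * X) = (14 + 4 * X) % 32 + 32 * ((14 + 4 * X) / 32) by omega, zeta32_pow_add_mul]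
  rcases hX with hX | hX <;> rw [hX, e] <;> norm_num <;>
    [exact zeta32_pow_re_pos' (by norm_num) (by norm_num); exact zeta32_pow_re_pos (by norm_num)]

/-- ★★ **BELOW-COHERENT COST-`5` WEIGHTS ROTATED BY `ζ²` HAVE POSITIVE REAL PART** (`−4√2·ζ^{10+4X}`: `X = 3` gives `4√2·ζ⁶`, `X = 0`
gives `4√2·ζ²⁶`). [cite: GlazmanManolescu2019, §1, Fig. 1 and eq. (1); Lemma 2.1, eq. (CR)] -/
theorem re_zeta2_mul_limitWeight_pos_of_belowCoherent (γ : YBWalk D a z) (ha : vertB a = true) (s : Fin 4)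
    (hz : vertB z = (slotDeg s == 0)) (hc : cost s γ.mids = 5) (hcoh : BelowCoherent s γ.mids) :
    0 < (zeta32 ^ 2 * limitWeight s γ.mids).re := by
  obtain ⟨rfl, hX⟩ := hcoh
  rw [limitWeight_eq_sqrt_of_cost_five γ ha 3 hz rfl hc, show slotSign 3 = -1 from rfl]
  have e : ∀ X : ℕ, zeta32 ^ 2 * (-1 * (4 * ((Real.sqrt 2 : ℝ) : ℂ)) * zeta32 ^ (8 + 4 * X)) =
      4 * (((Real.sqrt 2 : ℝ) : ℂ) * zeta32 ^ ((26 + 4 * X) % 32)) := by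
    intro X
    have h16 := zeta32_pow_sixteen
    rw [show zeta32 ^ 2 * (-1 * (4 * ((Real.sqrt 2 : ℝ) : ℂ)) * zeta32 ^ (8 + 4 * X)) =
      4 * (((Real.sqrt 2 : ℝ) : ℂ) * (-1 * (zeta32 ^ 2 * zeta32 ^ (8 + 4 * X)))) by ring, ← h16, ← pow_add, ← pow_add,
      show 16 + (2 + (8 + 4 * X)) = (26 + 4 * X) % 32 + 32 * ((26 + 4 * X) / 32) by omega, zeta32_pow_add_mul]
  rcases hX with hX | hX <;> rw [hX, e] <;> norm_num <;>
    [exact zeta32_pow_re_pos (by norm_num); exact zeta32_pow_re_pos' (by norm_num) (by norm_num)]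

end Classes

/-! ## The column-coherence criteria at a hole root -/

section Criterion

variable (Dl : List Face)

open Classical in
/-- ★★★ **THE ABOVE-COHERENCE CRITERION.** At a `W`-normalised hole root `a = w.side W` of `dom Dl` and a rooted rhombus `f₀`: if every
wound group member of limit cost `5` at `f₀` is ABOVE-COHERENT (slot `N`, phase index `3` or `6`) and there is at least one, the printed
Yang–Baxter vertex functional `VF_D(a, f₀; ·)` is NOT identically zero in the angle (finitely many zeros in `(0, π)`). This is the
form in which the census law at the cells above the root plaquette is to be proved. [cite: GlazmanManolescu2019, Lemma 2.1 and eq. (1)]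
[cite: Glazman2015WeightedSAW, Lemma 3.1 (proof)] -/
theorem vertexFunctional_printed_zero_set_finite_of_aboveCoherent {w f₀ : Face} (hh : holeFaceW w ∉ dom Dl)
    (hr : RootedFace (dom Dl) (w.side .W) f₀)
    (hcoh : ∀ ω ∈ (ΩG.setB2a (dom Dl) (w.side .W) f₀).filter (fun ω => ¬ω.Unwound hr),
      (cost (slotOfSide ω.1) ω.2.mids = 5 → AboveCoherent (slotOfSide ω.1) ω.2.mids) ∧
        (IsNS ω hr → cost (slotOfSide (ω.ext₃ hr).1) (ω.ext₃ hr).2.mids = 5 →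
          AboveCoherent (slotOfSide (ω.ext₃ hr).1) (ω.ext₃ hr).2.mids))
    (hex : ∃ ω ∈ (ΩG.setB2a (dom Dl) (w.side .W) f₀).filter (fun ω => ¬ω.Unwound hr),
      cost (slotOfSide ω.1) ω.2.mids = 5 ∨ (IsNS ω hr ∧ cost (slotOfSide (ω.ext₃ hr).1) (ω.ext₃ hr).2.mids = 5)) :
    {θ ∈ Set.Ioo 0 π | vertexFunctional (printedWeights θ) tFiveEighths (ybCoeff θ) Dl (w.side .W) f₀ = 0}.Finite ∧
      {θ ∈ Set.Ioo 0 π | vertexFunctional (printedWeights θ) tFiveEighths (ybCoeff θ) Dl (w.side .W) f₀ = 0}.ncard ≤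
        4 * maxExp Dl (w.side .W) f₀ + 1 - 5 := by
  have ha : vertB (w.side .W) = true := (vertB_side w).1
  have hpos : ∀ (zz : Side) (γ : YBWalk (dom Dl) (w.side .W) (f₀.side zz)), cost (slotOfSide zz) γ.mids = 5 →
      AboveCoherent (slotOfSide zz) γ.mids → 0 < (zeta32 ^ 6 * limitWeight (slotOfSide zz) γ.mids).re :=
    fun zz γ hc hco => re_zeta6_mul_limitWeight_pos_of_aboveCoherent γ ha (slotOfSide zz) (vertB_side_eq_slotDeg f₀ zz) hc hco
  refine vertexFunctional_printed_zero_set_finite_of_halfPlane_five Dl hh hr (zeta32 ^ 6) (fun ω hω => ?_) ?_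
  · obtain ⟨h1, h2⟩ := hcoh ω hω
    exact ⟨fun hc => (hpos ω.1 ω.2 hc (h1 hc)).le, fun hN hc => (hpos _ _ hc (h2 hN hc)).le⟩
  · obtain ⟨ω, hω, hcase⟩ := hex
    obtain ⟨h1, h2⟩ := hcoh ω hω
    refine ⟨ω, hω, ?_⟩
    rcases hcase with hc | ⟨hN, hc⟩
    · exact Or.inl ⟨hc, hpos ω.1 ω.2 hc (h1 hc)⟩
    · exact Or.inr ⟨hN, hc, hpos _ _ hc (h2 hN hc)⟩

open Classical in
/-- ★★★ **THE BELOW-COHERENCE CRITERION** (slot `S`, phase index `3` or `0`; rotation `ζ²`). [cite: GlazmanManolescu2019, Lemma 2.1 and eq. (1)]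
[cite: Glazman2015WeightedSAW, Lemma 3.1 (proof)] -/
theorem vertexFunctional_printed_zero_set_finite_of_belowCoherent {w f₀ : Face} (hh : holeFaceW w ∉ dom Dl)
    (hr : RootedFace (dom Dl) (w.side .W) f₀)
    (hcoh : ∀ ω ∈ (ΩG.setB2a (dom Dl) (w.side .W) f₀).filter (fun ω => ¬ω.Unwound hr),
      (cost (slotOfSide ω.1) ω.2.mids = 5 → BelowCoherent (slotOfSide ω.1) ω.2.mids) ∧
        (IsNS ω hr → cost (slotOfSide (ω.ext₃ hr).1) (ω.ext₃ hr).2.mids = 5 →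
          BelowCoherent (slotOfSide (ω.ext₃ hr).1) (ω.ext₃ hr).2.mids))
    (hex : ∃ ω ∈ (ΩG.setB2a (dom Dl) (w.side .W) f₀).filter (fun ω => ¬ω.Unwound hr),
      cost (slotOfSide ω.1) ω.2.mids = 5 ∨ (IsNS ω hr ∧ cost (slotOfSide (ω.ext₃ hr).1) (ω.ext₃ hr).2.mids = 5)) :
    {θ ∈ Set.Ioo 0 π | vertexFunctional (printedWeights θ) tFiveEighths (ybCoeff θ) Dl (w.side .W) f₀ = 0}.Finite ∧
      {θ ∈ Set.Ioo 0 π | vertexFunctional (printedWeights θ) tFiveEighths (ybCoeff θ) Dl (w.side .W) f₀ = 0}.ncard ≤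
        4 * maxExp Dl (w.side .W) f₀ + 1 - 5 := by
  have ha : vertB (w.side .W) = true := (vertB_side w).1
  have hpos : ∀ (zz : Side) (γ : YBWalk (dom Dl) (w.side .W) (f₀.side zz)), cost (slotOfSide zz) γ.mids = 5 →
      BelowCoherent (slotOfSide zz) γ.mids → 0 < (zeta32 ^ 2 * limitWeight (slotOfSide zz) γ.mids).re :=
    fun zz γ hc hco => re_zeta2_mul_limitWeight_pos_of_belowCoherent γ ha (slotOfSide zz) (vertB_side_eq_slotDeg f₀ zz) hc hco
  refine vertexFunctional_printed_zero_set_finite_of_halfPlane_five Dl hh hr (zeta32 ^ 2) (fun ω hω => ?_) ?_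
  · obtain ⟨h1, h2⟩ := hcoh ω hω
    exact ⟨fun hc => (hpos ω.1 ω.2 hc (h1 hc)).le, fun hN hc => (hpos _ _ hc (h2 hN hc)).le⟩
  · obtain ⟨ω, hω, hcase⟩ := hex
    obtain ⟨h1, h2⟩ := hcoh ω hω
    refine ⟨ω, hω, ?_⟩
    rcases hcase with hc | ⟨hN, hc⟩
    · exact Or.inl ⟨hc, hpos ω.1 ω.2 hc (h1 hc)⟩
    · exact Or.inr ⟨hN, hc, hpos _ _ hc (h2 hN hc)⟩

end Criterion

end Literature.Barriers.CriticalPhenomena.PlaquetteWalk
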